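import Literature.MathematicalPhysics.QuantumFieldTheory.Balaban1983to89.B4RegFieldHyps22

/-!
# [B4] LEMMA 2.2 (2.17) FOR A GENERAL (1.7)-REGULAR CONFIGURATION `Ã` CONSTANT ON THE BOUNDARY COLLAR OF `□` — members
# `G_k(□,Ã)`, `D^η_{Ã,μ}G_k(□,Ã)` on the whole printed parallelogram (corner `q = p = ∞`, all `1 ≤ p ≤ q < ∞`, the edge
# `q = ∞`) and the third member `G_k(□,Ã)D^{η*}_{Ã,μ}` at the two corners, with only «e sufficiently small»
# [Balaban1983RegularityDecay]

statement-level skeleton of published theorems with citation tags; proofs where landed; nothing here is a claim about the Yang–Mills mass gap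

CITATION HEADER.  T. Bałaban, *Regularity and decay of lattice Green's functions*, Commun. Math. Phys. **89** (1983)
571–597, doi:10.1007/bf01214744 [Balaban1983RegularityDecay] (cell paper B4; held text
`paper:balaban1983-cmp89-regularity-decay`, journal page = PDF page + 570; pp. 573, 577–579, 581, 583; Lemma 2.2 read
from the page renders `…regularity-decay-p007-x2.png`, `…-p008-x2.png`).  PDF held: yes.  Unit `lit-balaban-p35` gen 7
(Phase-2 proof seat), HOME `run/shared/lean/pub/lit-balaban/`.  WHAT IS REPRODUCED: SKELETON row **B4.Lem2.2** (Lemma 2.2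
(2.17)) for a GENERAL field satisfying the printed hypotheses (regular, constant near `∂□`) — file 2 of 4 of the
general-field Lemma 2.2 (file 1 `B4RegFieldHyps22`: the hypotheses package; file 3 `B4Lemma22RegFieldDual`: the third
member off the corners and (2.16); file 4 `B4Lemma22RegFieldFam`: b04's typed `B4.Lemma22Printed` on the family of all
such fields).  Companion of gen 6/7's `B4Eq220CubeField` / `B4Lemma22EdgesCubeField` (the same at the cube
configurations `Ã_j`).  Imports `B4RegFieldHyps22` (closure: the b2b lineage `B4Lemma22SupStair`, `B4Lemma22EtaBox`,
`B4Lemma22DualL1`, `B4Lemma22L1Stair`; gen 6's charge scalings).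

WHAT IS PRINTED (pp. 577–578, verbatim).  «Lemma 2.2. Let a rectangular parallelepiped □ be a sum of few large blocks
(e.g., as in the case of the cubes □_j), and let Ã be a regular vector field configuration in the sense of Proposition
I.2.1, constant in a neighbourhood of the boundary of □. Then for e sufficiently small and α < 1, there exists a
constant c₁ … (2.16) and a constant c₂ depending on d, p₁, such that ‖G_k(□,Ã)f‖_q, ‖D^η_{Ã,μ}G_k(□,Ã)f‖_q,
‖G_k(□,Ã)D^{η*}_{Ã,μ}f‖_q ≤ c₂‖f‖_p (2.17) for 1 ≤ p, q ≤ ∞, satisfying the condition 1/p − 1/p₁ ≤ 1/q ≤ 1/p with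
p₁ > d.»; p. 583: «For q = p = ∞, it is a special case of (2.16) … For q = p = 1 we get it by duality argument … the
operators G_k(□), ∂^η_μG_k(□), G_k(□)∂^{η*}_μ are bounded operators from L^{p₁}(□) with p₁ > d to L^∞(□) …»; p. 573
(1.7): «|(∂^η_μA)(x)| ≤ ce^{β−1}», «for e sufficiently small».

WHAT THIS MODULE PROVES (`d + 1` lattice dimensions, the print's «p₁ > d» is `p₁ > d + 1`; box `□ = Π_μ[0, nM_μ)`,
`n = L^k`, `L = ℓ + 1 ≥ 2`, `1 ≤ M_μ ≤ S`; `Ã` a component field, (1.7)-regular on `□` with constants `c, β > 0` and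
constant on the two-layer collar of `∂□` (`B4RegFieldHyps22`); its bond function `compField Ã` at coupling `e/n`;
staircase block contours; `‖·‖_{p,η} = lpW`, `‖·‖_∞ = supN`).  QUANTIFIER ORDER (the print's): `C` first (Lemma 2.2 at
charge `1`: `d`, `N`, flow, `L`, windows, `p₁`), then for `(c, β, S)` a threshold `e₁`, then the instance (mesh, `a`,
`m²`, box, field, `0 < e ≤ e₁`).
* **`lemma22_sup_regField`** — the corner `q = p = ∞`: `‖G_k(□,Ã)Φ‖_∞ ≤ C‖Φ‖_∞`, `‖D^η_{Ã,μ}G_k(□,Ã)Φ‖_∞ ≤ C‖Φ‖_∞`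
  (`B4Lemma22SupStair.lemma22_17_sup_stair` discharged).
* **`lemma22_weighted_regField`** — all `1 ≤ p ≤ q < ∞` with `1/p − 1/q ≤ 1/p₁`: `‖G_k(□,Ã)Φ‖_{q,η} ≤ C‖Φ‖_{p,η}`,
  `‖D^η_{Ã,μ}G_k(□,Ã)Φ‖_{q,η} ≤ C‖Φ‖_{p,η}` (`B4Lemma22EtaBox.lemma22_17_weighted_stair` discharged).
* **`lemma22_psup_regField`** — the edge `q = ∞`, `p₁ ≤ p < ∞`: `‖G_k(□,Ã)Φ‖_∞`, `‖D^η_{Ã,μ}G_k(□,Ã)Φ‖_∞ ≤ C‖Φ‖_{p,η}`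
  (`B4Lemma22EtaBox.lemma22_17_weighted_box_sup` discharged).
* **`lemma22_dual_corners_regField`** — the third member at the corners: `‖G(D_Ã)ᵀΦ‖_{1,η} ≤ C‖Φ‖_{1,η}`
  (`B4Lemma22DualL1.lemma22_17_l1_stair`), `‖G(D_Ã)ᵀΦ‖_∞ ≤ C‖Φ‖_∞` (`B4Lemma22L1Stair.lemma22_17_l1_deriv_stair`).
Mechanism: the lineage's theorems at charge `1` applied to `(e/n)Ã = (e/n)A₀ + A′`
(`B4CubeFieldHyps22.greenA_smul/derivA_smul`, `B4RegFieldHyps22.smul_compField`), hypotheses by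
`B4RegFieldHyps22.regField_hyps/regField_pkg`, smallness by `regField_threshold`.

HONEST SCOPE.  (i) Boxes with the lineage's staircase block contours (Lemma 2.2 is stated for «a rectangular
parallelepiped □»); the collar reading of «constant in a neighbourhood of the boundary» as in `B4RegFieldHyps22`;
`A₀ = Ã(0)`, so `e₁` depends on `(c, β, S)` («c′ = dMc»).  (ii) `C` depends on `(d, N, flow Lipschitz constant, L, a₋,
a₊, m²₊[, p₁])` (print: «depending on d, p₁»), as in every node of this lineage.  Theorems only; no `def`, no `Prop`
fact, no `sorry`; axioms standard.
-/

namespace Literature.MathematicalPhysics.QuantumFieldTheory.Balaban1983to89.B4Lemma22RegField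

open Finset Matrix
open Literature.MathematicalPhysics.QuantumFieldTheory.Balaban1983to89.B4GaugeCovariance
open Literature.MathematicalPhysics.QuantumFieldTheory.Balaban1983to89.B4Reflection242 (boxDom nbrs)
open Literature.MathematicalPhysics.QuantumFieldTheory.Balaban1983to89.B4Lower18Regular (e1 baseEmb stairContour
  stairContour_end lsum)
open Literature.MathematicalPhysics.QuantumFieldTheory.Balaban1983to89.B4Lower18RegularRegion (compField)
open Literature.MathematicalPhysics.QuantumFieldTheory.Balaban1983to89.B4Lemma22Reduce231 (supN supN_nonneg l1N
  l1N_nonneg)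
open Literature.MathematicalPhysics.QuantumFieldTheory.Balaban1983to89.B4Lemma22ReduceZero (Box opA greenA derivA)
open Literature.MathematicalPhysics.QuantumFieldTheory.Balaban1983to89.B4Lemma22EtaBox (vol vol_pos lpW lpW_nonneg
  lemma22_17_weighted_box_sup lemma22_17_weighted_stair)
open Literature.MathematicalPhysics.QuantumFieldTheory.Balaban1983to89.B4Lemma22SupStair (lemma22_17_sup_stair)
open Literature.MathematicalPhysics.QuantumFieldTheory.Balaban1983to89.B4Lemma22DualL1 (lemma22_17_l1_stair)
open Literature.MathematicalPhysics.QuantumFieldTheory.Balaban1983to89.B4Lemma22L1Stair (lemma22_17_l1_deriv_stair)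
open Literature.MathematicalPhysics.QuantumFieldTheory.Balaban1983to89.B4CubeFields22 (fluct)
open Literature.MathematicalPhysics.QuantumFieldTheory.Balaban1983to89.B4CubeFieldHyps22 (greenA_smul derivA_smul
  aSeq_window)
open Literature.MathematicalPhysics.QuantumFieldTheory.Balaban1983to89.B4Lemma22EdgesCubeField (lpW_one_eq)
open Literature.MathematicalPhysics.QuantumFieldTheory.Balaban1983to89.B4RegFieldHyps22

noncomputable section

variable {d : ℕ} {ι : Type} [Fintype ι] [DecidableEq ι]

/-! ## §1. The corner `q = p = ∞` and the weighted members `G`, `D_ÃG` -/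

/-- **LEMMA 2.2 (2.17), SUP MEMBERS, FOR A GENERAL (1.7)-REGULAR `Ã` CONSTANT ON THE COLLAR, WITH ONLY «e SUFFICIENTLY
SMALL»**: there is `C > 0` (Lemma 2.2 at charge `1`) such that for every `(c, β)`, `β > 0` and side bound `S` there is
`e₁ > 0` with: for every mesh `n = L^k`, `a, m²` of the windows, box `□ = Π_μ[0, nM_μ)` (`1 ≤ M_μ ≤ S`), every component
field `Ã` (1.7)-regular on `□` and constant on the collar, `0 < e ≤ e₁` and `Φ`:
`‖G_k(□,Ã)Φ‖_∞ ≤ C‖Φ‖_∞` and `‖D^η_{Ã,μ}G_k(□,Ã)Φ‖_∞ ≤ C‖Φ‖_∞` for every `μ` (coupling `e/n`, staircase contours;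
`B4Lemma22SupStair.lemma22_17_sup_stair` with its field hypotheses and smallness conditions DISCHARGED).
[cite: Balaban1983RegularityDecay, Lemma 2.2 (2.17) p. 578 with p. 583 «For q = p = ∞», (2.23) p. 579, (1.7) p. 573] -/
theorem lemma22_sup_regField (F : OrthFlow ι) {ℓ₁ : ℝ} (hℓ₁ : 0 ≤ ℓ₁)
    (hLip : ∀ t (v : ι → ℝ), ((F.U t - 1) *ᵥ v) ⬝ᵥ ((F.U t - 1) *ᵥ v) ≤ (ℓ₁ * t) ^ 2 * (v ⬝ᵥ v))
    (d ℓ : ℕ) (hℓ : 1 ≤ ℓ) (amin aplus m2plus : ℝ) (ha : 0 < amin) :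
    ∃ C : ℝ, 0 < C ∧ ∀ (creg β : ℝ), 0 ≤ creg → 0 < β → ∀ (S : ℕ),
      ∃ e₁ : ℝ, 0 < e₁ ∧ ∀ (k : ℕ), 1 ≤ k → ∀ (hn : 1 ≤ (ℓ + 1) ^ k),
      ∀ (a m2 : ℝ), amin ≤ a → a ≤ aplus → 0 ≤ m2 → m2 ≤ m2plus →
      ∀ (M : Fin (d + 1) → ℕ), (∀ i, 1 ≤ M i) → (∀ i, M i ≤ S) →
      ∀ (Ac : (Fin (d + 1) → ℤ) → Fin (d + 1) → ℝ) (e : ℝ), 0 < e → e ≤ e₁ →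
        (∀ x ∈ Box d ℓ k M, ∀ μ ν : Fin (d + 1),
          |Ac (x + e1 μ) ν - Ac x ν| ≤ creg * e ^ (β - 1) / ((ℓ + 1) ^ k : ℕ)) →
        (∀ x ∈ Box d ℓ k M, ∀ μ : Fin (d + 1),
          (x μ = 0 ∨ (((ℓ + 1) ^ k * M μ : ℕ) : ℤ) ≤ x μ + 2) → ∀ ν, Ac x ν = Ac 0 ν) →
      ∀ Φ : ↥(Box d ℓ k M) × ι → ℝ,
        supN (greenA d F (e / ((ℓ + 1) ^ k : ℕ)) ℓ k a m2 M (baseEmb hn M) (stairContour hn M)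
            (fun u v => compField Ac u.1 v.1) *ᵥ Φ) ≤ C * supN Φ ∧
        ∀ μ : Fin (d + 1),
          supN (derivA d F (e / ((ℓ + 1) ^ k : ℕ)) ℓ k M (fun u v => compField Ac u.1 v.1) μ
              *ᵥ (greenA d F (e / ((ℓ + 1) ^ k : ℕ)) ℓ k a m2 M (baseEmb hn M) (stairContour hn M)
                  (fun u v => compField Ac u.1 v.1) *ᵥ Φ))
            ≤ C * supN Φ := by
  obtain ⟨c, hc, hL⟩ := lemma22_17_sup_stair F hℓ₁ hLip 1 d ℓ hℓ amin aplus m2plus ha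
  set C : ℝ := (2 + ℓ₁) * (2 * (((d : ℝ) + 2) * c)) with hC_def
  have hC0 : 0 < C := by rw [hC_def]; positivity
  refine ⟨C, hC0, fun creg β hcreg hβ S => ?_⟩
  obtain ⟨e₁, he₁, hth⟩ := regField_threshold d (c := c) (aplus := aplus) hℓ₁ hc.le ha hcreg hβ S
  refine ⟨e₁, he₁, ?_⟩
  intro k hk hn a m2 e1' e2 e3 e4 M hM hS Ac e he hle h17 hcol Φ
  obtain ⟨hak1, hak2⟩ := aSeq_window hℓ hk ha e1' e2
  obtain ⟨hθ1, hsm2, hsm⟩ := hth e he hle _ hak1 hak2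
  obtain ⟨-, hA', hder, hbd⟩ := regField_hyps (d := d) hn hM hS hcreg he h17 hcol (β := β)
  have hθ0 : 0 ≤ ((d : ℝ) + 1) * S * creg * e ^ β := by
    have := (Real.rpow_pos_of_pos he β).le; positivity
  have hθ'0 : 0 ≤ creg * e ^ β := by
    have := (Real.rpow_pos_of_pos he β).le; positivity
  obtain ⟨main1, main2⟩ := hL k hk hn a m2 e1' e2 e3 e4 M hM (fun μ => e / ((ℓ + 1) ^ k : ℕ) * Ac 0 μ) _ _ _
    hθ0 hA' hθ'0 hder hbd hsm2 hsm Φ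
  have hc2 : 0 ≤ 2 * (((d : ℝ) + 2) * c) := by positivity
  have hC1 : 2 * (((d : ℝ) + 2) * c) ≤ C := by rw [hC_def]; nlinarith
  have hC2 : (1 + ℓ₁ * (((d : ℝ) + 1) * S * creg * e ^ β)) * (2 * (((d : ℝ) + 2) * c)) ≤ C := by
    rw [hC_def]
    refine mul_le_mul_of_nonneg_right ?_ hc2
    have : ℓ₁ * (((d : ℝ) + 1) * S * creg * e ^ β) ≤ ℓ₁ * 1 := mul_le_mul_of_nonneg_left hθ1 hℓ₁
    linarith
  constructor
  · rw [greenA_smul, smul_compField]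
    have hsum : 0 ≤ ∑ μ, supN (B4Lemma22ReduceZero.derivA0 d F 1 ℓ k M (fun μ => e / ((ℓ + 1) ^ k : ℕ) * Ac 0 μ) μ
        *ᵥ (greenA d F 1 ℓ k a m2 M (baseEmb hn M) (stairContour hn M)
            (constBond (fun μ => e / ((ℓ + 1) ^ k : ℕ) * Ac 0 μ) Subtype.val
              + fun u v => e / ((ℓ + 1) ^ k : ℕ) * fluct (Box d ℓ k M) (Ac 0) Ac u v) *ᵥ Φ)) :=
      Finset.sum_nonneg fun μ _ => supN_nonneg _
    have h1 := (le_add_of_nonneg_right hsum).trans main1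
    exact h1.trans (mul_le_mul_of_nonneg_right hC1 (supN_nonneg Φ))
  · intro μ
    rw [derivA_smul, greenA_smul, smul_compField]
    exact (main2 μ).trans (mul_le_mul_of_nonneg_right hC2 (supN_nonneg Φ))

/-- **LEMMA 2.2 (2.17), `η`-WEIGHTED `L^p → L^q` MEMBERS `G_k(□,Ã)`, `D^η_{Ã,μ}G_k(□,Ã)`, FOR A GENERAL (1.7)-REGULAR
`Ã` CONSTANT ON THE COLLAR, WITH ONLY «e SUFFICIENTLY SMALL»** (all pairs `1 ≤ p ≤ q < ∞` with `1/p − 1/q ≤ 1/p₁`,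
`p₁ > d + 1`; the constant independent of `η`): `‖G_k(□,Ã)Φ‖_{q,η} ≤ C‖Φ‖_{p,η}` and `‖D^η_{Ã,μ}G_k(□,Ã)Φ‖_{q,η} ≤
C‖Φ‖_{p,η}` for every `μ` (`B4Lemma22EtaBox.lemma22_17_weighted_stair` with its field hypotheses and smallness conditions
DISCHARGED). [cite: Balaban1983RegularityDecay, Lemma 2.2 (2.17) p. 578 with p. 583, (2.23) p. 579, (1.7) p. 573] -/
theorem lemma22_weighted_regField (F : OrthFlow ι) {ℓ₁ : ℝ} (hℓ₁ : 0 ≤ ℓ₁)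
    (hLip : ∀ t (v : ι → ℝ), ((F.U t - 1) *ᵥ v) ⬝ᵥ ((F.U t - 1) *ᵥ v) ≤ (ℓ₁ * t) ^ 2 * (v ⬝ᵥ v))
    (d ℓ : ℕ) (hℓ : 1 ≤ ℓ) (amin aplus m2plus : ℝ) (ha : 0 < amin) {p₁ : ℝ} (hp₁ : (d : ℝ) + 1 < p₁) :
    ∃ C : ℝ, 0 < C ∧ ∀ (creg β : ℝ), 0 ≤ creg → 0 < β → ∀ (S : ℕ),
      ∃ e₁ : ℝ, 0 < e₁ ∧ ∀ (k : ℕ), 1 ≤ k → ∀ (hn : 1 ≤ (ℓ + 1) ^ k),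
      ∀ (a m2 : ℝ), amin ≤ a → a ≤ aplus → 0 ≤ m2 → m2 ≤ m2plus →
      ∀ (M : Fin (d + 1) → ℕ), (∀ i, 1 ≤ M i) → (∀ i, M i ≤ S) →
      ∀ (Ac : (Fin (d + 1) → ℤ) → Fin (d + 1) → ℝ) (e : ℝ), 0 < e → e ≤ e₁ →
        (∀ x ∈ Box d ℓ k M, ∀ μ ν : Fin (d + 1),
          |Ac (x + e1 μ) ν - Ac x ν| ≤ creg * e ^ (β - 1) / ((ℓ + 1) ^ k : ℕ)) →
        (∀ x ∈ Box d ℓ k M, ∀ μ : Fin (d + 1),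
          (x μ = 0 ∨ (((ℓ + 1) ^ k * M μ : ℕ) : ℤ) ≤ x μ + 2) → ∀ ν, Ac x ν = Ac 0 ν) →
      ∀ (p q : ℝ), 1 ≤ p → p ≤ q → p⁻¹ - q⁻¹ ≤ p₁⁻¹ →
      ∀ Φ : ↥(Box d ℓ k M) × ι → ℝ,
        lpW d ℓ k q (greenA d F (e / ((ℓ + 1) ^ k : ℕ)) ℓ k a m2 M (baseEmb hn M) (stairContour hn M)
            (fun u v => compField Ac u.1 v.1) *ᵥ Φ) ≤ C * lpW d ℓ k p Φ ∧
        ∀ μ : Fin (d + 1),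
          lpW d ℓ k q (derivA d F (e / ((ℓ + 1) ^ k : ℕ)) ℓ k M (fun u v => compField Ac u.1 v.1) μ
              *ᵥ (greenA d F (e / ((ℓ + 1) ^ k : ℕ)) ℓ k a m2 M (baseEmb hn M) (stairContour hn M)
                  (fun u v => compField Ac u.1 v.1) *ᵥ Φ))
            ≤ C * lpW d ℓ k p Φ := by
  obtain ⟨c, hc, C', hC', hL⟩ := lemma22_17_weighted_stair F hℓ₁ hLip 1 d ℓ hℓ amin aplus m2plus ha hp₁
  set C : ℝ := (2 + ℓ₁) * (2 * C') with hC_def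
  have hC0 : 0 < C := by rw [hC_def]; positivity
  refine ⟨C, hC0, fun creg β hcreg hβ S => ?_⟩
  obtain ⟨e₁, he₁, hth⟩ := regField_threshold d (c := c) (aplus := aplus) hℓ₁ hc.le ha hcreg hβ S
  refine ⟨e₁, he₁, ?_⟩
  intro k hk hn a m2 e1' e2 e3 e4 M hM hS Ac e he hle h17 hcol p q hp hpq hσ Φ
  obtain ⟨hak1, hak2⟩ := aSeq_window hℓ hk ha e1' e2
  obtain ⟨hθ1, hsm2, hsm⟩ := hth e he hle _ hak1 hak2
  obtain ⟨-, hA', hder, hbd⟩ := regField_hyps (d := d) hn hM hS hcreg he h17 hcol (β := β)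
  have hθ0 : 0 ≤ ((d : ℝ) + 1) * S * creg * e ^ β := by
    have := (Real.rpow_pos_of_pos he β).le; positivity
  have hθ'0 : 0 ≤ creg * e ^ β := by
    have := (Real.rpow_pos_of_pos he β).le; positivity
  obtain ⟨main0, -, main2⟩ := hL k hk hn a m2 e1' e2 e3 e4 M hM (fun μ => e / ((ℓ + 1) ^ k : ℕ) * Ac 0 μ) _ _ _
    hθ0 hA' hθ'0 hder hbd hsm2 hsm p q hp hpq hσ Φ
  have hc2 : 0 ≤ 2 * C' := by positivity
  have hC1 : 2 * C' ≤ C := by rw [hC_def]; nlinarith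
  have hC2 : (1 + ℓ₁ * (((d : ℝ) + 1) * S * creg * e ^ β)) * (2 * C') ≤ C := by
    rw [hC_def]
    refine mul_le_mul_of_nonneg_right ?_ hc2
    have : ℓ₁ * (((d : ℝ) + 1) * S * creg * e ^ β) ≤ ℓ₁ * 1 := mul_le_mul_of_nonneg_left hθ1 hℓ₁
    linarith
  constructor
  · rw [greenA_smul, smul_compField]
    exact main0.trans (mul_le_mul_of_nonneg_right hC1 (lpW_nonneg d ℓ k p Φ))
  · intro μ
    rw [derivA_smul, greenA_smul, smul_compField]
    exact (main2 μ).trans (mul_le_mul_of_nonneg_right hC2 (lpW_nonneg d ℓ k p Φ))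

/-! ## §2. The edge `q = ∞`, `p₁ ≤ p < ∞`, members `G`, `D_ÃG` -/

/-- **LEMMA 2.2 (2.17), THE EDGE `q = ∞`, `p₁ ≤ p < ∞`, MEMBERS `G_k(□,Ã)`, `D^η_{Ã,μ}G_k(□,Ã)`, FOR A GENERAL
(1.7)-REGULAR `Ã` CONSTANT ON THE COLLAR, WITH ONLY «e SUFFICIENTLY SMALL»** («bounded operators from L^{p₁}(□) … to
L^∞(□)»): `‖G_k(□,Ã)Φ‖_∞ ≤ C‖Φ‖_{p,η}` and `‖D^η_{Ã,μ}G_k(□,Ã)Φ‖_∞ ≤ C‖Φ‖_{p,η}` for every `μ`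
(`B4Lemma22EtaBox.lemma22_17_weighted_box_sup` with every operator-side and field hypothesis DISCHARGED).
[cite: Balaban1983RegularityDecay, Lemma 2.2 (2.17) p. 578 with (2.40)–(2.41) p. 583, (2.23) p. 579, (1.7) p. 573] -/
theorem lemma22_psup_regField (F : OrthFlow ι) {ℓ₁ : ℝ} (hℓ₁ : 0 ≤ ℓ₁)
    (hLip : ∀ t (v : ι → ℝ), ((F.U t - 1) *ᵥ v) ⬝ᵥ ((F.U t - 1) *ᵥ v) ≤ (ℓ₁ * t) ^ 2 * (v ⬝ᵥ v))
    (d ℓ : ℕ) (hℓ : 1 ≤ ℓ) (amin aplus m2plus : ℝ) (ha : 0 < amin) {p₁ : ℝ} (hp₁ : (d : ℝ) + 1 < p₁) :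
    ∃ C : ℝ, 0 < C ∧ ∀ (creg β : ℝ), 0 ≤ creg → 0 < β → ∀ (S : ℕ),
      ∃ e₁ : ℝ, 0 < e₁ ∧ ∀ (k : ℕ), 1 ≤ k → ∀ (hn : 1 ≤ (ℓ + 1) ^ k),
      ∀ (a m2 : ℝ), amin ≤ a → a ≤ aplus → 0 ≤ m2 → m2 ≤ m2plus →
      ∀ (M : Fin (d + 1) → ℕ), (∀ i, 1 ≤ M i) → (∀ i, M i ≤ S) →
      ∀ (Ac : (Fin (d + 1) → ℤ) → Fin (d + 1) → ℝ) (e : ℝ), 0 < e → e ≤ e₁ →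
        (∀ x ∈ Box d ℓ k M, ∀ μ ν : Fin (d + 1),
          |Ac (x + e1 μ) ν - Ac x ν| ≤ creg * e ^ (β - 1) / ((ℓ + 1) ^ k : ℕ)) →
        (∀ x ∈ Box d ℓ k M, ∀ μ : Fin (d + 1),
          (x μ = 0 ∨ (((ℓ + 1) ^ k * M μ : ℕ) : ℤ) ≤ x μ + 2) → ∀ ν, Ac x ν = Ac 0 ν) →
      ∀ (p : ℝ), p₁ ≤ p →
      ∀ Φ : ↥(Box d ℓ k M) × ι → ℝ,
        supN (greenA d F (e / ((ℓ + 1) ^ k : ℕ)) ℓ k a m2 M (baseEmb hn M) (stairContour hn M)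
            (fun u v => compField Ac u.1 v.1) *ᵥ Φ) ≤ C * lpW d ℓ k p Φ ∧
        ∀ μ : Fin (d + 1),
          supN (derivA d F (e / ((ℓ + 1) ^ k : ℕ)) ℓ k M (fun u v => compField Ac u.1 v.1) μ
              *ᵥ (greenA d F (e / ((ℓ + 1) ^ k : ℕ)) ℓ k a m2 M (baseEmb hn M) (stairContour hn M)
                  (fun u v => compField Ac u.1 v.1) *ᵥ Φ))
            ≤ C * lpW d ℓ k p Φ := by
  obtain ⟨c, hc, C', hC', hL⟩ := lemma22_17_weighted_box_sup F hℓ₁ hLip 1 d ℓ hℓ amin aplus m2plus ha hp₁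
  set C : ℝ := (2 + ℓ₁) * (2 * C') with hC_def
  have hC0 : 0 < C := by rw [hC_def]; positivity
  refine ⟨C, hC0, fun creg β hcreg hβ S => ?_⟩
  obtain ⟨e₁, he₁, hth⟩ := regField_threshold d (c := c) (aplus := aplus) hℓ₁ hc.le ha hcreg hβ S
  refine ⟨e₁, he₁, ?_⟩
  intro k hk hn a m2 e1' e2 e3 e4 M hM hS Ac e he hle h17 hcol p hp Φ
  obtain ⟨hak1, hak2⟩ := aSeq_window hℓ hk ha e1' e2
  obtain ⟨hθ1, -, hsm⟩ := hth e he hle _ hak1 hak2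
  have ha' : 0 < a := lt_of_lt_of_le ha e1'
  obtain ⟨-, hunit, hθ0, hA', hθ'0, hder, hbd, hτ0, hτ⟩ :=
    regField_pkg F hℓ hk hn ha' e3 hM hS hcreg he h17 hcol (β := β)
  obtain ⟨main0, -, main2⟩ := hL k hk a m2 e1' e2 e3 e4 M hM (baseEmb hn M) (stairContour hn M)
    (fun y x hw => stairContour_end hn M y x hw) (fun μ => e / ((ℓ + 1) ^ k : ℕ) * Ac 0 μ) _ _ _ _
    hunit hθ0 hA' hθ'0 hder hbd hτ0 hτ hsm p hp Φ
  have hc2 : 0 ≤ 2 * C' := by positivity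
  have hC1 : 2 * C' ≤ C := by rw [hC_def]; nlinarith
  have hC2 : (1 + ℓ₁ * (((d : ℝ) + 1) * S * creg * e ^ β)) * (2 * C') ≤ C := by
    rw [hC_def]
    refine mul_le_mul_of_nonneg_right ?_ hc2
    have : ℓ₁ * (((d : ℝ) + 1) * S * creg * e ^ β) ≤ ℓ₁ * 1 := mul_le_mul_of_nonneg_left hθ1 hℓ₁
    linarith
  constructor
  · rw [greenA_smul, smul_compField]
    exact main0.trans (mul_le_mul_of_nonneg_right hC1 (lpW_nonneg d ℓ k p Φ))
  · intro μ
    rw [derivA_smul, greenA_smul, smul_compField]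
    exact (main2 μ).trans (mul_le_mul_of_nonneg_right hC2 (lpW_nonneg d ℓ k p Φ))

/-! ## §3. The third member at the two corners -/

/-- **LEMMA 2.2 (2.17), THIRD MEMBER `G_k(□,Ã)D^{η*}_{Ã,μ}`, THE CORNERS `q = p = 1` AND `q = p = ∞`, FOR A GENERAL
(1.7)-REGULAR `Ã` CONSTANT ON THE COLLAR, WITH ONLY «e SUFFICIENTLY SMALL»**: `‖G_k(□,Ã)(D^η_{Ã,μ})ᵀΦ‖_{1,η} ≤ C‖Φ‖_{1,η}`
(«For q = p = 1 we get it by duality argument»; `B4Lemma22DualL1.lemma22_17_l1_stair` discharged, `lpW_one_eq`) and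
`‖G_k(□,Ã)(D^η_{Ã,μ})ᵀΦ‖_∞ ≤ C‖Φ‖_∞` (`B4Lemma22L1Stair.lemma22_17_l1_deriv_stair` discharged), for every `μ`.
[cite: Balaban1983RegularityDecay, Lemma 2.2 (2.17) p. 578 with pp. 581, 583, (2.23) p. 579, (1.7) p. 573] -/
theorem lemma22_dual_corners_regField (F : OrthFlow ι) {ℓ₁ : ℝ} (hℓ₁ : 0 ≤ ℓ₁)
    (hLip : ∀ t (v : ι → ℝ), ((F.U t - 1) *ᵥ v) ⬝ᵥ ((F.U t - 1) *ᵥ v) ≤ (ℓ₁ * t) ^ 2 * (v ⬝ᵥ v))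
    (d ℓ : ℕ) (hℓ : 1 ≤ ℓ) (amin aplus m2plus : ℝ) (ha : 0 < amin) :
    ∃ C : ℝ, 0 < C ∧ ∀ (creg β : ℝ), 0 ≤ creg → 0 < β → ∀ (S : ℕ),
      ∃ e₁ : ℝ, 0 < e₁ ∧ ∀ (k : ℕ), 1 ≤ k → ∀ (hn : 1 ≤ (ℓ + 1) ^ k),
      ∀ (a m2 : ℝ), amin ≤ a → a ≤ aplus → 0 ≤ m2 → m2 ≤ m2plus →
      ∀ (M : Fin (d + 1) → ℕ), (∀ i, 1 ≤ M i) → (∀ i, M i ≤ S) →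
      ∀ (Ac : (Fin (d + 1) → ℤ) → Fin (d + 1) → ℝ) (e : ℝ), 0 < e → e ≤ e₁ →
        (∀ x ∈ Box d ℓ k M, ∀ μ ν : Fin (d + 1),
          |Ac (x + e1 μ) ν - Ac x ν| ≤ creg * e ^ (β - 1) / ((ℓ + 1) ^ k : ℕ)) →
        (∀ x ∈ Box d ℓ k M, ∀ μ : Fin (d + 1),
          (x μ = 0 ∨ (((ℓ + 1) ^ k * M μ : ℕ) : ℤ) ≤ x μ + 2) → ∀ ν, Ac x ν = Ac 0 ν) →
      ∀ (Φ : ↥(Box d ℓ k M) × ι → ℝ) (μ : Fin (d + 1)),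
        lpW d ℓ k 1 ((greenA d F (e / ((ℓ + 1) ^ k : ℕ)) ℓ k a m2 M (baseEmb hn M) (stairContour hn M)
              (fun u v => compField Ac u.1 v.1)
            * (derivA d F (e / ((ℓ + 1) ^ k : ℕ)) ℓ k M (fun u v => compField Ac u.1 v.1) μ)ᵀ) *ᵥ Φ)
          ≤ C * lpW d ℓ k 1 Φ ∧
        supN ((greenA d F (e / ((ℓ + 1) ^ k : ℕ)) ℓ k a m2 M (baseEmb hn M) (stairContour hn M)
              (fun u v => compField Ac u.1 v.1)
            * (derivA d F (e / ((ℓ + 1) ^ k : ℕ)) ℓ k M (fun u v => compField Ac u.1 v.1) μ)ᵀ) *ᵥ Φ)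
          ≤ C * supN Φ := by
  obtain ⟨c, hc, hL⟩ := lemma22_17_l1_stair F hℓ₁ hLip 1 d ℓ hℓ amin aplus m2plus ha
  obtain ⟨c', hc', hL'⟩ := lemma22_17_l1_deriv_stair F hℓ₁ hLip 1 d ℓ hℓ amin aplus m2plus ha
  set C : ℝ := (2 + ℓ₁) * (2 * (((d : ℝ) + 2) * (c + c'))) with hC_def
  have hC0 : 0 < C := by rw [hC_def]; positivity
  refine ⟨C, hC0, fun creg β hcreg hβ S => ?_⟩
  obtain ⟨e₁, he₁, hth⟩ := regField_threshold d (c := c) (aplus := aplus) hℓ₁ hc.le ha hcreg hβ S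
  obtain ⟨e₂, he₂, hth'⟩ := regField_threshold d (c := c') (aplus := aplus) hℓ₁ hc'.le ha hcreg hβ S
  refine ⟨min e₁ e₂, lt_min he₁ he₂, ?_⟩
  intro k hk hn a m2 e1' e2 e3 e4 M hM hS Ac e he hle h17 hcol Φ μ
  obtain ⟨hak1, hak2⟩ := aSeq_window hℓ hk ha e1' e2
  obtain ⟨hθ1, hsm2, hsm⟩ := hth e he (hle.trans (min_le_left _ _)) _ hak1 hak2
  obtain ⟨-, -, hsm'⟩ := hth' e he (hle.trans (min_le_right _ _)) _ hak1 hak2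
  obtain ⟨-, hA', hder, hbd⟩ := regField_hyps (d := d) hn hM hS hcreg he h17 hcol (β := β)
  have hθ0 : 0 ≤ ((d : ℝ) + 1) * S * creg * e ^ β := by
    have := (Real.rpow_pos_of_pos he β).le; positivity
  have hθ'0 : 0 ≤ creg * e ^ β := by
    have := (Real.rpow_pos_of_pos he β).le; positivity
  obtain ⟨-, main1⟩ := hL k hk hn a m2 e1' e2 e3 e4 M hM (fun μ => e / ((ℓ + 1) ^ k : ℕ) * Ac 0 μ) _ _ _
    hθ0 hA' hθ'0 hder hbd hsm2 hsm Φ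
  obtain ⟨-, -, -, main2⟩ := hL' k hk hn a m2 e1' e2 e3 e4 M hM (fun μ => e / ((ℓ + 1) ^ k : ℕ) * Ac 0 μ) _ _ _
    hθ0 hA' hθ'0 hder hbd hsm2 hsm' Φ
  have hθle : ℓ₁ * (((d : ℝ) + 1) * S * creg * e ^ β) ≤ ℓ₁ * 1 := mul_le_mul_of_nonneg_left hθ1 hℓ₁
  have hd2 : 0 ≤ (d : ℝ) + 2 := by positivity
  have hC1 : (1 + ℓ₁ * (((d : ℝ) + 1) * S * creg * e ^ β)) * (2 * (((d : ℝ) + 2) * c)) ≤ C := by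
    rw [hC_def]
    refine mul_le_mul (by linarith) ?_ (by positivity) (by positivity)
    nlinarith
  have hC2 : (1 + ℓ₁ * (((d : ℝ) + 1) * S * creg * e ^ β)) * (2 * (((d : ℝ) + 2) * c')) ≤ C := by
    rw [hC_def]
    refine mul_le_mul (by linarith) ?_ (by positivity) (by positivity)
    nlinarith
  have hvol : 0 < (vol d ℓ k)⁻¹ := inv_pos.2 (vol_pos d ℓ k)
  constructor
  · rw [derivA_smul, greenA_smul, smul_compField, lpW_one_eq, lpW_one_eq, ← mul_assoc, mul_comm C, mul_assoc]
    refine mul_le_mul_of_nonneg_left ?_ hvol.le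
    exact (main1 μ).trans (mul_le_mul_of_nonneg_right hC1 (l1N_nonneg Φ))
  · rw [derivA_smul, greenA_smul, smul_compField]
    exact (main2 μ).trans (mul_le_mul_of_nonneg_right hC2 (supN_nonneg Φ))

end

end Literature.MathematicalPhysics.QuantumFieldTheory.Balaban1983to89.B4Lemma22RegField
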